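import Summits.FinalStateConjecture.FinalStateConjecture.Theorems.EIHFluxBalanceEIHFluxEvaluationKSComplex
import Summits.FinalStateConjecture.FinalStateConjecture.Theorems.EIHFluxBalanceEIHFluxEvaluationRicciLinear
import Literature.Geometry.Lorentzian.LandauLifshitzPrincipalPart
import Literature.Geometry.Lorentzian.LandauLifshitzFluxLaw
import Summits.FinalStateConjecture.FinalStateConjecture.Theorems.EIHFluxBalanceLLBalanceLawIdentities

/-!
# Route EIHFluxBalance — `EIHFluxEvaluation` (c): the Landau–Lifshitz complex, pseudotensor and
# momentum flux of a Kerr–Schild vacuum family vanish identically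

Helper file (`--supports stmt-FinalStateConjecture-10188`), the assembled form of clause (c) of the
informal item `EIHFluxEvaluation` ("for exact boosted Kerr the fluxes vanish identically") for an
abstract **Kerr–Schild vacuum family**: `K` of class `C^∞` on an open `V ⊆ E4` with null rank-one
values, such that `g_s = η + sK` is Ricci-flat at the relevant points for all `s` in a set `S`
accumulating at `0` (for boosted Kerr: `K = 2Hℓ⊗ℓ/M`, `S = (0, ∞)` the masses). Then, in these
Kerr–Schild coordinates,

* `Σ_α ∂_α h^{μνα}(g_s)(x) = 0` for EVERY real `s` (`emComplex_ksFamily_eq_zero`): the complex is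
  `s ·` the flat-space principal part of `(16π)⁻¹ Σ ∂∂H` on `T = D²K(x)` (`emComplex_ksFamily`),
  which by LL's cancellation identity (`principalPart_cancel`, (96.8)) is `(8π)⁻¹` times the
  linearised Einstein tensor of `K` at `η`, and that vanishes by the linearised vacuum equation
  (`ricci_linearization`);
* hence `t^{μν}_LL(g_s)(x) = 0` wherever `Ric(g_s)(x) = 0` (`pseudotensor_ksFamily_eq_zero`,
  LL (96.7) with `G^{μν} = 0`), the momentum flux `∮ (−g)t^{μk} n_k dσ` through every coordinate
  sphere inside `V` vanishes (`momentumFlux_ksFamily_eq_zero`), and the quasi-local four-momentum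
  `P^μ(t; ξ, R)` of every such sphere is conserved, `dP^μ/dt = 0` (LL (96.10)/(96.16),
  `hasDerivAt_quasiLocalMomentum_ksFamily`) — for every member of the family.

Physics: Gürses–Gürsey, J. Math. Phys. 16 (1975) 2385, §IV (for Kerr–Schild metrics the
Einstein and Landau–Lifshitz pseudotensors vanish in Kerr–Schild coordinates; the field equations
are linear); Virbhadra, Phys. Rev. D 41 (1990) 1086 / 42 (1990) 2919 (energy–momentum complexes of
Kerr–Newman in KS Cartesian coordinates reduce to the Maxwell part, zero for `Q = 0`).
-/

noncomputable section

open Filter Set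
open scoped Matrix Topology ContDiff

namespace Summit.FinalStateConjecture.FinalStateConjecture.Theorems

namespace KSFlux

open Literature.Geometry.Lorentzian Literature.Geometry.Lorentzian.LandauLifshitz
set_option maxSynthPendingDepth 3

open MeasureTheory MeasureTheory.Measure

variable {K : E4 → E4 →L[ℝ] E4 →L[ℝ] ℝ}

section Vacuum

variable {V : Set E4} {x : E4}

/-- **A Kerr–Schild family is a family of metrics**: for `K` `C^∞` on the open `V` with null
rank-one values, every `g_s = η + sK`, `s ∈ ℝ`, is `C^∞`, symmetric and nondegenerate on `V`.
[cite: KerrSchild1965, §1] -/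
theorem isMetricOn_ksFamily (hV : IsOpen V) (hK : ContDiffOn ℝ ∞ K V)
    (hKS : ∀ y ∈ V, ∃ φ : ℝ, ∃ ℓ : E4 →L[ℝ] ℝ, ∃ n : E4,
      (∀ w, Minkowski.bilin n w = ℓ w) ∧ ℓ n = 0 ∧ K y = φ • E4.tmul ℓ ℓ) (s : ℝ) :
    MetricCoord.IsMetricOn (fun z ↦ Minkowski.bilin + s • K z) V where
  isOpen := hV
  contDiffOn := contDiffOn_const.add (hK.const_smul s)
  symm y hy v w := by
    obtain ⟨φ, ℓ, n, -, -, hKy⟩ := hKS y hy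
    exact ksFamily_apply_symm hKy s v w
  isInvertible y hy := by
    obtain ⟨φ, ℓ, n, hn, hℓ, hKy⟩ := hKS y hy
    exact isInvertible_ksFamily hn hℓ hKy s

/-- `det (g_s)_{μν} ≠ 0` on `V` (it is `−1`, `metricDet_ksFamily`). [cite: KerrSchild1965, §1] -/
theorem metricDet_ksFamily_ne_zero
    (hKS : ∀ y ∈ V, ∃ φ : ℝ, ∃ ℓ : E4 →L[ℝ] ℝ, ∃ n : E4,
      (∀ w, Minkowski.bilin n w = ℓ w) ∧ ℓ n = 0 ∧ K y = φ • E4.tmul ℓ ℓ) (s : ℝ) :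
    ∀ y ∈ V, metricDet (fun z ↦ Minkowski.bilin + s • K z) y ≠ 0 := fun y hy ↦ by
  obtain ⟨φ, ℓ, n, hn, hℓ, hKy⟩ := hKS y hy
  rw [metricDet_ksFamily hn hℓ hKy s]
  norm_num

/-- **The Landau–Lifshitz complex of a Kerr–Schild vacuum family vanishes identically, for every
value of the parameter.** If `Ric(g_s)(x) = 0` for all `s` in a set `S` with
`0 ∈ closure (S ∖ {0})`, then `Σ_α ∂_α h^{μνα}(g_s)(x) = 0` for ALL real `s`: by
`emComplex_ksFamily` the complex is `s` times
the flat principal part of `(16π)⁻¹Σ∂∂H` on `T = D²K(x)`, which `principalPart_cancel` (LL (96.8))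
equates with `−2d ×` the principal part of `G^{μν}`, zero by `ricci_linearization`.
[cite: LandauLifshitz1975, §96 (96.8)] -/
theorem emComplex_ksFamily_eq_zero (hV : IsOpen V) (hK : ContDiffOn ℝ ∞ K V)
    (hKS : ∀ y ∈ V, ∃ φ : ℝ, ∃ ℓ : E4 →L[ℝ] ℝ, ∃ n : E4,
      (∀ w, Minkowski.bilin n w = ℓ w) ∧ ℓ n = 0 ∧ K y = φ • E4.tmul ℓ ℓ)
    (hx : x ∈ V) {S : Set ℝ} (hvac : ∀ s ∈ S, MetricCoord.ricAt (fun z ↦ Minkowski.bilin + s • K z)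
        x = 0)
    (hS : (0 : ℝ) ∈ closure (S \ {0})) (s : ℝ) (μ ν : Fin 4) :
    emComplex (fun z ↦ Minkowski.bilin + s • K z) x μ ν = 0 := by
  have hmet := isMetricOn_ksFamily hV hK hKS
  -- a nonzero vacuum parameter, to read off the symmetries of `D²K(x)` from those of `D²g_{s₀}`
  obtain ⟨s₀, hs₀S, hs₀⟩ := (mem_closure_iff_frequently.mp hS).exists
  have hs₀0 : s₀ ≠ 0 := hs₀
  have hT₁ : ∀ p q r t : Fin 4,
      fderiv ℝ (fderiv ℝ K) x (E4.basisVector p) (E4.basisVector q) (E4.basisVector r)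
        (E4.basisVector t) = fderiv ℝ (fderiv ℝ K) x (E4.basisVector q) (E4.basisVector p)
        (E4.basisVector r) (E4.basisVector t) := by
    intro p q r t
    have h := congrArg (fun L : E4 →L[ℝ] E4 →L[ℝ] ℝ ↦ L (E4.basisVector r) (E4.basisVector t))
      ((hmet s₀).fderiv_fderiv_comm hx (E4.basisVector p) (E4.basisVector q))
    simp only [fderiv_fderiv_ksFamily hV hK hx s₀, FunLike.coe_smul, Pi.smul_apply,
      smul_eq_mul] at h
    exact mul_left_cancel₀ hs₀0 h
  have hT₂ : ∀ p q r t : Fin 4,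
      fderiv ℝ (fderiv ℝ K) x (E4.basisVector p) (E4.basisVector q) (E4.basisVector r)
        (E4.basisVector t) = fderiv ℝ (fderiv ℝ K) x (E4.basisVector p) (E4.basisVector q)
        (E4.basisVector t) (E4.basisVector r) := by
    intro p q r t
    have h := (hmet s₀).fderiv_fderiv_symm hx (E4.basisVector p) (E4.basisVector q)
      (E4.basisVector r) (E4.basisVector t)
    simp only [fderiv_fderiv_ksFamily hV hK hx s₀, FunLike.coe_smul, Pi.smul_apply,
      smul_eq_mul] at h
    exact mul_left_cancel₀ hs₀0 h
  have hU : ∀ i j : Fin 4, (Matrix.diagonal ![(-1 : ℝ), 1, 1, 1]) i j = (Matrix.diagonal ![(-1 :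
      ℝ), 1, 1, 1]) j i := fun i j ↦ by
    by_cases h : i = j
    · rw [h]
    · rw [Matrix.diagonal_apply_ne _ h, Matrix.diagonal_apply_ne _ (Ne.symm h)]
  -- LL's cancellation identity with the linearised vacuum equation inserted
  have hpc := principalPart_cancel (Matrix.diagonal ![(-1 : ℝ), 1, 1, 1]) (fun p q r t ↦ fderiv ℝ
      (fderiv ℝ K) x (E4.basisVector p)
    (E4.basisVector q) (E4.basisVector r) (E4.basisVector t)) (-1) hU hT₁ hT₂ μ ν
  have hRL := ricci_linearization hK hx (fun s hs ↦ hmet s) hvac hS (fun p q r t ↦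
    fderiv ℝ (fderiv ℝ K) x (E4.basisVector p) (E4.basisVector q) (E4.basisVector r)
      (E4.basisVector t)) (fun _ _ _ _ ↦ rfl)
  simp only [hRL, mul_zero, Finset.sum_const_zero, zero_mul, sub_self, add_zero] at hpc
  rw [emComplex_ksFamily hV hK hKS hx s]
  simp only [fderiv_superpotential_minkowski_apply, gram]
  rw [hpc, mul_zero, mul_zero]

/-- **The Landau–Lifshitz pseudotensor of a Kerr–Schild vacuum family vanishes**: under the
hypotheses of `emComplex_ksFamily_eq_zero`, `t^{μν}_LL(g_s)(x) = 0` for every `s` with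
`Ric(g_s)(x) = 0` (LL (96.7): `t = (−g)⁻¹ Σ∂h − G/8π`, both terms zero).
[cite: LandauLifshitz1975, §96 (96.7)] -/
theorem pseudotensor_ksFamily_eq_zero (hV : IsOpen V) (hK : ContDiffOn ℝ ∞ K V)
    (hKS : ∀ y ∈ V, ∃ φ : ℝ, ∃ ℓ : E4 →L[ℝ] ℝ, ∃ n : E4,
      (∀ w, Minkowski.bilin n w = ℓ w) ∧ ℓ n = 0 ∧ K y = φ • E4.tmul ℓ ℓ)
    (hx : x ∈ V) {S : Set ℝ} (hvac : ∀ s ∈ S, MetricCoord.ricAt (fun z ↦ Minkowski.bilin + s • K z)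
        x = 0)
    (hS : (0 : ℝ) ∈ closure (S \ {0})) {s : ℝ} (hs : MetricCoord.ricAt (fun z ↦ Minkowski.bilin + s
        • K z) x = 0)
    (μ ν : Fin 4) :
    pseudotensor (fun z ↦ Minkowski.bilin + s • K z) x μ ν = 0 := by
  rw [pseudotensor, emComplex_ksFamily_eq_zero hV hK hKS hx hvac hS s,
    LLBalance.einsteinUpper_eq_zero_of_ricAt_eq_zero hs, mul_zero, mul_zero, sub_zero]

/-- **The Landau–Lifshitz momentum flux of a Kerr–Schild vacuum family through any coordinate
sphere vanishes**: if `g_s` is Ricci-flat on `V` for all `s ∈ S`, `0 ∈ closure (S ∖ {0})`, then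
`Φ^μ(t; ξ, R) = ∮ Σ_k (−g)t^{μk}_LL n_k dσ = 0` for every `s ∈ S` and every sphere
`{t} × {|y − ξ| = R} ⊆ V` (the integrand is zero). [cite: LandauLifshitz1975, §96 (96.11)] -/
theorem momentumFlux_ksFamily_eq_zero (hV : IsOpen V) (hK : ContDiffOn ℝ ∞ K V)
    (hKS : ∀ y ∈ V, ∃ φ : ℝ, ∃ ℓ : E4 →L[ℝ] ℝ, ∃ n : E4,
      (∀ w, Minkowski.bilin n w = ℓ w) ∧ ℓ n = 0 ∧ K y = φ • E4.tmul ℓ ℓ)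
    {S : Set ℝ} (hvac : ∀ s ∈ S, ∀ y ∈ V, MetricCoord.ricAt (fun z ↦ Minkowski.bilin + s • K z) y =
        0)
    (hS : (0 : ℝ) ∈ closure (S \ {0})) {s : ℝ} (hs : s ∈ S) {t R : ℝ} {ξ : E3}
    (hsph : ∀ y ∈ Metric.sphere ξ R, E4.ofTimeSpace t y ∈ V) (μ : Fin 4) :
    momentumFlux (fun z ↦ Minkowski.bilin + s • K z) t ξ R μ = 0 := by
  rw [momentumFlux]
  refine setIntegral_eq_zero_of_forall_eq_zero fun y hy ↦ ?_
  refine Finset.sum_eq_zero fun k _ ↦ ?_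
  rw [pseudotensor_ksFamily_eq_zero hV hK hKS (hsph y hy) (fun s' hs' ↦ hvac s' hs' _ (hsph y hy))
    hS (hvac s hs _ (hsph y hy)), mul_zero, zero_mul, zero_div]

/-- **The quasi-local Landau–Lifshitz four-momentum of a coordinate sphere is conserved along a
Kerr–Schild vacuum family, for every value of the parameter**: `d/dt P^μ(t; ξ, R) = 0` whenever
`{t} × {|y − ξ| = R} ⊆ V`, `R > 0` — LL's balance law `dP^μ/dt = −∮ Σ_k (Σ_α∂_α h^{μkα}) n_k dσ`
(`hasDerivAt_quasiLocalMomentum`, (96.10)/(96.16)) with the complex identically zero.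
[cite: LandauLifshitz1975, §96 (96.16)] -/
theorem hasDerivAt_quasiLocalMomentum_ksFamily (hV : IsOpen V) (hK : ContDiffOn ℝ ∞ K V)
    (hKS : ∀ y ∈ V, ∃ φ : ℝ, ∃ ℓ : E4 →L[ℝ] ℝ, ∃ n : E4,
      (∀ w, Minkowski.bilin n w = ℓ w) ∧ ℓ n = 0 ∧ K y = φ • E4.tmul ℓ ℓ)
    {S : Set ℝ} (hvac : ∀ s ∈ S, ∀ y ∈ V, MetricCoord.ricAt (fun z ↦ Minkowski.bilin + s • K z) y =
        0)
    (hS : (0 : ℝ) ∈ closure (S \ {0})) (s : ℝ) {t R : ℝ} {ξ : E3} (hR : 0 < R)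
    (hsph : ∀ y ∈ Metric.sphere ξ R, E4.ofTimeSpace t y ∈ V) (μ : Fin 4) :
    HasDerivAt (fun t' ↦ quasiLocalMomentum (fun z ↦ Minkowski.bilin + s • K z) t' ξ R μ) 0 t := by
  have h := hasDerivAt_quasiLocalMomentum hV (isMetricOn_ksFamily hV hK hKS s).contDiffOn
    (metricDet_ksFamily_ne_zero hKS s) hR hsph μ
  have h0 : ∫ y in Metric.sphere ξ R, ∑ k : Fin 3,
      emComplex (fun z ↦ Minkowski.bilin + s • K z) (E4.ofTimeSpace t y) μ k.succ * (y - ξ) k / R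
          ∂(μHE[2] : Measure E3) = 0 := by
    refine setIntegral_eq_zero_of_forall_eq_zero fun y hy ↦ Finset.sum_eq_zero fun k _ ↦ ?_
    rw [emComplex_ksFamily_eq_zero hV hK hKS (hsph y hy) (fun s' hs' ↦ hvac s' hs' _ (hsph y hy))
      hS s, zero_mul, zero_div]
  rw [h0, neg_zero] at h
  exact h

end Vacuum

end KSFlux

end Summit.FinalStateConjecture.FinalStateConjecture.Theorems

end
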